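import Summits.CriticalPhenomena.CardyFormulaZ2.Theorems.CardyIKTransportIKMixedBoxCrossingDefectGlueColDefs
import Summits.CriticalPhenomena.CardyFormulaZ2.Theorems.CardyIKTransportIKMixedBoxCrossingDefectStubRowFactorisation

/-!
# Stub `stub_colFactorisation` of the line `defect-closure-exploration` (crux `IKMixedBoxCrossing`,
# stmt-CriticalPhenomena-5911)

COLUMN FACTORISATION (exact Markov property of the gauge colour field across the anchor cell column `0`, finite
cylinder form, every column pattern `S`): for an event `A` read on the right half-box `Rt = [1, h] × [b, b+k)`, an
event `B` read on the left half-box `Lf = [-h, -1] × [b, b+k)` and the axis cylinder `C_ζ` (colours `ζ` of the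
cells `(0, b+j)`, `j < k`): `ν(A ∩ B ∩ C_ζ) = 2^k ν(A ∩ C_ζ) ν(B ∩ C_ζ)`. This is the transpose (rows ↔ columns) of
the landed `stub_rowFactorisation`, and the proof is the transposed bit bookkeeping.

PROOF (no conditional measures). Write `ω = (A, B, Pb, Pf, C)` (column / row signs, biased / fair plaquettes,
coins) and SHEAR the column signs, `A x ↦ A x ⊕ A 0` for `x ≠ 0` (`measurePreserving_cshearΩ`, `μIK`-preserving: on
the sign coordinate it is literally the map of `RowTwistStub.measurePreserving_shear`), so
`ν(E ∩ C_ζ) = μIK(shear⁻¹ (obs⁻¹ (E ∩ C_ζ)))`. After the shear: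
* the axis cell `(0, y)` has an empty anchored rectangle and is black iff `B y ⊕ A 0` (`axis_csheared`): `C_ζ`
  pulls back to the cylinder `Cyl = {B (b+j) ⊕ A 0 = ζ_j ∀ j}`, which reads the row signs and `A 0` only and has
  mass `2^{-k}` (`real_rowSignCyl`: a row-sign cylinder for either value of `A 0`);
* a cell `v = (x, b+j)`, `x ≠ 0`, is black iff `ζ_j ⊕ A x ⊕` (parity of the plaquettes of the anchored rectangle
  of `v`) on `Cyl` (`colour_csheared`): off the axis, the colours of the window rows are those of ONE synthetic
  configuration `tw ω` reading neither `B` nor `A 0`, so that `shear⁻¹ (obs⁻¹ (E ∩ C_ζ)) = tw⁻¹ E ∩ Cyl` for every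
  event `E` determined off the axis column (`A`, `B`, `A ∩ B`);
* `tw⁻¹ A` reads `A` on `x ≥ 1`, the plaquettes of the face columns `≥ 0` and the coins of the face columns `≥ 1`;
  `tw⁻¹ B` reads `A` on `x ≤ -1` and the plaquettes and coins of the face columns `≤ -1`; `Cyl` reads `B` and
  `A 0`: DISJOINT coordinate sets of the product measure, hence independent (`CondBoxStub.real_inter_eq_mul`) —
  whatever the pattern `S` (it only selects which plaquette field a face column reads).
Therefore `ν(A ∩ B ∩ C_ζ) = μ(tw⁻¹A) μ(tw⁻¹B) 2^{-k}`, `ν(A ∩ C_ζ) = μ(tw⁻¹A) 2^{-k}`, `ν(B ∩ C_ζ) = μ(tw⁻¹B) 2^{-k}`.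
-/

noncomputable section

namespace Summit.CriticalPhenomena.CardyFormulaZ2.Cruxes.IKMixedBoxCrossing.DefectClosureExploration

open scoped Classical BigOperators
open MeasureTheory ProbabilityTheory
open Literature.Probability.Percolation Literature.Probability.LatticeModels
open Summit.CriticalPhenomena.CardyFormulaZ2.Theorems.IKLinearTransport.PinnedDiagramExchange (Ω μIK blackSet parSet
  antiSet Obs obs νmix determinedOn crsw_mem_blackSet_rowFlip)
open Summit.CriticalPhenomena.CardyFormulaZ2.Theorems.IKLinearTransport.PinnedDiagramExchange.CouplingToLimits
  (measurable_xor measurable_mem_parSet measurable_mem_antiSet measurable_card_filter isProbabilityMeasure_μIK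
    measurable_obs)
open Summit.CriticalPhenomena.CardyFormulaZ2.Theorems.IKQuarterTurn (mem_Ico_min_max)
open Summit.CriticalPhenomena.CardyFormulaZ2.Cruxes.IKMixedBoxCrossing.XorRectangleFlip.IncrStub (mem_parSet_congr)
open RowFactorisationStub (xor_iff_iff mem_antiSet_congr)

namespace ColFactorisationStub

/-! ## §1 Small tools -/

/-- Membership in the right half-box. -/
theorem mem_rtBox {b : ℤ} {k h : ℕ} {v : Site 2} :
    v ∈ rtBox b k h ↔ 1 ≤ v 0 ∧ v 0 ≤ h ∧ b ≤ v 1 ∧ v 1 < b + k := Iff.rfl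

/-- Membership in the left half-box. -/
theorem mem_lfBox {b : ℤ} {k h : ℕ} {v : Site 2} :
    v ∈ lfBox b k h ↔ -(h : ℤ) ≤ v 0 ∧ v 0 ≤ -1 ∧ b ≤ v 1 ∧ v 1 < b + k := Iff.rfl

/-- Exclusive-or bookkeeping on the axis column (the toggle `r` is off). -/
theorem xor_axis_aux {a c r : Prop} (hr : ¬ r) : (Xor (Xor a c) r ↔ Xor c a) := by
  grind

/-- Exclusive-or bookkeeping off the axis column (`A 0` cancels against the axis colour `b`). -/
theorem xor_colour_aux {a a₀ c p n b : Prop} (hb : Xor c a₀ ↔ b) (hn : n) :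
    (Xor (Xor a (Xor c p)) (a₀ ∧ n) ↔ Xor b (Xor a p)) := by
  grind

/-- The anchored rectangles of the right cells consist of faces of the face columns `≥ 0`. -/
theorem faces_right : ∀ x : ℤ, 0 < x → ∀ f : ℤ × ℤ, f.1 ∈ Finset.Ico (min 0 x) (max 0 x) →
    (![f.1, f.2] : Site 2) ∈ {g : Site 2 | 0 ≤ g 0} := by
  intro x hx f hf
  rw [mem_Ico_min_max] at hf
  show (0 : ℤ) ≤ f.1
  omega

/-- The anchored rectangles of the left cells consist of faces of the face columns `< 0`. -/
theorem faces_left : ∀ x : ℤ, x < 0 → ∀ f : ℤ × ℤ, f.1 ∈ Finset.Ico (min 0 x) (max 0 x) →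
    (![f.1, f.2] : Site 2) ∈ {g : Site 2 | g 0 < 0} := by
  intro x hx f hf
  rw [mem_Ico_min_max] at hf
  show f.1 < 0
  omega

/-! ## §2 The column-sign shear and the colours after it -/

/-- The shear `A x ↦ A x ⊕ A 0` (`x ≠ 0`) acting on the column-sign coordinate preserves `μIK`. -/
theorem measurePreserving_cshearΩ :
    MeasurePreserving (fun ω : Ω => (({x : ℤ | Xor (x ∈ ω.1) ((0 : ℤ) ∈ ω.1 ∧ x ≠ 0)}, ω.2) : Ω)) μIK μIK := by
  unfold μIK
  exact RowTwistStub.measurePreserving_shear.prod (MeasurePreserving.id _)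

/-- Colours after the column-sign shear: the cell `v` is toggled iff `0 ∈ A ∧ v 0 ≠ 0`. -/
theorem mem_blackSet_cshear (S : Set ℤ) (ω : Ω) (v : Site 2) :
    v ∈ blackSet S ((({x : ℤ | Xor (x ∈ ω.1) ((0 : ℤ) ∈ ω.1 ∧ x ≠ 0)}, ω.2) : Ω)) ↔
      Xor (v ∈ blackSet S ω) ((0 : ℤ) ∈ ω.1 ∧ v 0 ≠ 0) := by
  rw [RowTwistStub.shear_eq_symmDiff]
  exact crsw_mem_blackSet_rowFlip S _ ω v

/-- AXIS COLUMN: the anchored rectangle of an axis cell is empty, so `(0, y)` is black iff `A 0 ⊕ B y`. -/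
theorem mem_blackSet_col0 (S : Set ℤ) (ω : Ω) (y : ℤ) :
    (![0, y] : Site 2) ∈ blackSet S ω ↔ Xor ((0 : ℤ) ∈ ω.1) (y ∈ ω.2.1) := by
  simp [blackSet, RowTwistStub.xor_false_right]

/-- AXIS COLUMN after the shear: `(0, y)` is black iff `B y ⊕ A 0` (the shear fixes the axis column). -/
theorem axis_csheared (S : Set ℤ) (ω : Ω) (y : ℤ) :
    ((![0, y] : Site 2) ∈ blackSet S ((({x : ℤ | Xor (x ∈ ω.1) ((0 : ℤ) ∈ ω.1 ∧ x ≠ 0)}, ω.2) : Ω)) ↔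
      Xor (y ∈ ω.2.1) ((0 : ℤ) ∈ ω.1)) := by
  rw [mem_blackSet_cshear, mem_blackSet_col0]
  exact xor_axis_aux fun h => h.2 (by simp)

/-- OFF THE AXIS COLUMN after the shear: if the axis cell of the row of `v` reads `b`, then `v` (`v 0 ≠ 0`) is black
iff `b ⊕ A (v 0) ⊕` (parity of the plaquettes of the anchored rectangle of `v`) — neither row sign nor `A 0`. -/
theorem colour_csheared (S : Set ℤ) (ω : Ω) (v : Site 2) (hv : v 0 ≠ 0) {b : Bool}
    (hb : Xor (v 1 ∈ ω.2.1) ((0 : ℤ) ∈ ω.1) ↔ b = true) :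
    (v ∈ blackSet S ((({x : ℤ | Xor (x ∈ ω.1) ((0 : ℤ) ∈ ω.1 ∧ x ≠ 0)}, ω.2) : Ω)) ↔
      Xor (b = true) (Xor (v 0 ∈ ω.1)
        (Odd ((Finset.Ico (min 0 (v 0)) (max 0 (v 0)) ×ˢ Finset.Ico (min 0 (v 1)) (max 0 (v 1))).filter
          (fun f : ℤ × ℤ => (![f.1, f.2] : Site 2) ∈ parSet S ω)).card))) := by
  rw [mem_blackSet_cshear]
  simp only [blackSet, Set.mem_setOf_eq]
  exact xor_colour_aux hb hv

/-! ## §3 The factorisation -/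

/-- Mass of a row-sign cylinder on the `k` window rows: `2^{-k}`. -/
theorem real_rowSignCyl (b : ℤ) (k : ℕ) (η : Fin k → Bool) :
    μIK.real {ω : Ω | ∀ j : Fin k, (b + j ∈ ω.2.1 ↔ η j = true)} = (1 / 2) ^ k := by
  have hπ : MeasurePreserving (fun ω : Ω => ω.2.1) μIK (sitePercolation ℤ half) := by
    unfold μIK
    exact measurePreserving_fst.comp measurePreserving_snd
  have h1 := hπ.measureReal_preimage (s := {T : Set ℤ | ∀ j : Fin k, (b + j ∈ T ↔ η j = true)})
    (measurableSet_setOf.2 (Measurable.forall fun j => (measurable_set_mem _).iff measurable_const)).nullMeasurableSet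
  rw [CondBoxStub.sitePercolation_real_cylinder half (e := fun j : Fin k => b + ((j : ℕ) : ℤ))
    (fun i j hij => Fin.ext (by simp only [add_right_inj, Nat.cast_inj] at hij; exact hij)) η] at h1
  rw [show {ω : Ω | ∀ j : Fin k, (b + j ∈ ω.2.1 ↔ η j = true)} =
      (fun ω : Ω => ω.2.1) ⁻¹' {T | ∀ j : Fin k, (b + j ∈ T ↔ η j = true)} from rfl, h1,
    Finset.prod_congr rfl fun i _ => show (if η i then ((half : unitInterval) : ℝ) else 1 - half) = 1 / 2 by
      cases η i <;> norm_num [half], Finset.prod_const, Finset.card_univ, Fintype.card_fin]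

/-- The factorisation `ν(A ∩ B ∩ C_ζ) = 2^k ν(A ∩ C_ζ) ν(B ∩ C_ζ)` for events of the two half-boxes. -/
theorem main (S : Set ℤ) (b : ℤ) (k h : ℕ) {A B : Set Obs} (hAm : MeasurableSet A) (hBm : MeasurableSet B)
    (hA : A ∈ determinedOn (rtBox b k h)) (hB : B ∈ determinedOn (lfBox b k h)) (ζ : Fin k → Bool) :
    (νmix S).real (A ∩ B ∩ colCyl b k ζ) =
      (2 : ℝ) ^ k * (νmix S).real (A ∩ colCyl b k ζ) * (νmix S).real (B ∩ colCyl b k ζ) := by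
  haveI := isProbabilityMeasure_μIK
  -- VOCABULARY: the shear, the rectangle parities, the synthetic configuration, the axis cylinder
  set σ : Ω → Ω := fun ω => ((({x : ℤ | Xor (x ∈ ω.1) ((0 : ℤ) ∈ ω.1 ∧ x ≠ 0)}, ω.2)) : Ω)
  set RP : Site 2 → Ω → Prop := fun v ω =>
    Odd (((Finset.Ico (min 0 (v 0)) (max 0 (v 0)) ×ˢ Finset.Ico (min 0 (v 1)) (max 0 (v 1))).filter
      fun f : ℤ × ℤ => (![f.1, f.2] : Site 2) ∈ parSet S ω).card) with hRP
  set tw : Ω → Obs := fun ω =>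
    ({v | ∃ j : Fin k, v 1 = b + j ∧ Xor (ζ j = true) (Xor (v 0 ∈ ω.1) (RP v ω))}, antiSet S ω) with htw
  set Cyl : Set Ω := {ω | ∀ j : Fin k, (Xor (b + j ∈ ω.2.1) ((0 : ℤ) ∈ ω.1) ↔ ζ j = true)}
  -- MEASURABILITY
  have mA : ∀ x : ℤ, Measurable fun ω : Ω => x ∈ ω.1 := fun x => (measurable_set_mem x).comp measurable_fst
  have mB : ∀ y : ℤ, Measurable fun ω : Ω => y ∈ ω.2.1 := fun y => (measurable_set_mem y).comp measurable_snd.fst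
  have mRP : ∀ v, Measurable (RP v) := fun v =>
    (measurable_of_countable fun n : ℕ => Odd n).comp (measurable_card_filter _ fun f => measurable_mem_parSet S _)
  have mtw : Measurable tw :=
    (measurable_set_iff.2 fun v => Measurable.exists fun j => measurable_const.and
      (measurable_xor measurable_const (measurable_xor (mA _) (mRP v)))).prodMk
      (measurable_set_iff.2 (measurable_mem_antiSet S))
  have mCyl : MeasurableSet Cyl := measurableSet_setOf.2 (Measurable.forall fun j =>
    (measurable_xor (mB _) (mA 0)).iff measurable_const)
  have mcol : MeasurableSet (colCyl b k ζ) := measurableSet_setOf.2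
    (Measurable.forall fun j => ((measurable_set_mem _).comp measurable_fst).iff measurable_const)
  -- AXIS COLUMN after the shear
  have hax : ∀ (ω : Ω) (y : ℤ), ((![0, y] : Site 2) ∈ blackSet S (σ ω) ↔ Xor (y ∈ ω.2.1) ((0 : ℤ) ∈ ω.1)) :=
    fun ω y => axis_csheared S ω y
  -- THE SYNTHETIC CONFIGURATION agrees with the sheared observables off the axis column, on `Cyl`
  have hkey : ∀ {E : Set Obs} {Λ : Set (Site 2)}, E ∈ determinedOn Λ →
      (∀ v ∈ Λ, b ≤ v 1 ∧ v 1 < b + k ∧ v 0 ≠ 0) → ∀ ω ∈ Cyl, (obs S (σ ω) ∈ E ↔ tw ω ∈ E) := by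
    intro E Λ hE hΛ ω hω
    refine hE (obs S (σ ω)) (tw ω) fun v hv => ⟨?_, Iff.rfl⟩
    obtain ⟨h0, h1, h2⟩ := hΛ v hv
    obtain ⟨j, hj⟩ : ∃ j : Fin k, v 1 = b + j :=
      ⟨⟨(v 1 - b).toNat, by omega⟩, by simp only [Int.toNat_of_nonneg (by omega : (0:ℤ) ≤ v 1 - b)]; omega⟩
    refine (colour_csheared S ω v h2 (b := ζ j) (by rw [hj]; exact hω j)).trans ⟨fun hx => ⟨j, hj, hx⟩, ?_⟩
    rintro ⟨j', hj', hx⟩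
    obtain rfl : j' = j := Fin.ext (by omega)
    exact hx
  -- TRANSPORT: `ν(E ∩ C_ζ) = μIK (shear⁻¹ (obs⁻¹ (E ∩ C_ζ))) = μIK (tw⁻¹ E ∩ Cyl)`
  have hν : ∀ {E : Set Obs}, MeasurableSet E → (∀ ω ∈ Cyl, (obs S (σ ω) ∈ E ↔ tw ω ∈ E)) →
      (νmix S).real (E ∩ colCyl b k ζ) = μIK.real (tw ⁻¹' E ∩ Cyl) := by
    intro E hEm hE
    have hm : MeasurableSet (E ∩ colCyl b k ζ) := hEm.inter mcol
    have hpre : σ ⁻¹' (obs S ⁻¹' (E ∩ colCyl b k ζ)) = tw ⁻¹' E ∩ Cyl := by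
      ext ω
      have hc : obs S (σ ω) ∈ colCyl b k ζ ↔ ω ∈ Cyl := forall_congr' fun j => iff_congr (hax ω (b + j)) Iff.rfl
      simp only [Set.mem_preimage, Set.mem_inter_iff]
      exact ⟨fun hx => ⟨(hE ω (hc.1 hx.2)).1 hx.1, hc.1 hx.2⟩, fun hx => ⟨(hE ω hx.2).2 hx.1, hc.2 hx.2⟩⟩
    rw [show νmix S = μIK.map (obs S) from rfl, map_measureReal_apply (measurable_obs S) hm,
      ← measurePreserving_cshearΩ.measureReal_preimage (measurable_obs S hm).nullMeasurableSet]
    exact congrArg μIK.real hpre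
  -- LOCALITY of the synthetic configuration: it reads `A (v 0)`, the plaquettes of the anchored rectangle, the coin
  have hproj : ∀ {E : Set Obs} {Λ : Set (Site 2)}, E ∈ determinedOn Λ → ∀ (As : Set ℤ) (F C : Set (Site 2)),
      (∀ v ∈ Λ, v 0 ∈ As) →
      (∀ v ∈ Λ, ∀ f : ℤ × ℤ, f.1 ∈ Finset.Ico (min 0 (v 0)) (max 0 (v 0)) → (![f.1, f.2] : Site 2) ∈ F) →
      (∀ v ∈ Λ, v ∈ C) → ∀ ω : Ω,
        (tw ((ω.1 ∩ As, (ω.2.1 ∩ ∅, (ω.2.2.1 ∩ F, (ω.2.2.2.1 ∩ F, ω.2.2.2.2 ∩ C)))) : Ω) ∈ E ↔ tw ω ∈ E) := by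
    intro E Λ hE As F C hAs hF hC ω
    have hP : ∀ g : Site 2, g ∈ F →
        (g ∈ parSet S ((ω.1 ∩ As, (ω.2.1 ∩ ∅, (ω.2.2.1 ∩ F, (ω.2.2.2.1 ∩ F, ω.2.2.2.2 ∩ C)))) : Ω) ↔
          g ∈ parSet S ω) :=
      fun g hg => mem_parSet_congr S ⟨fun h => h.1, fun h => ⟨h, hg⟩⟩ ⟨fun h => h.1, fun h => ⟨h, hg⟩⟩
    refine hE _ _ fun v hv => ⟨?_, mem_antiSet_congr S ⟨fun h => h.1, fun h => ⟨h, hC v hv⟩⟩⟩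
    simp only [htw, hRP, Set.mem_setOf_eq]
    refine exists_congr fun j => and_congr_right fun _ => CondBoxStub.xor_congr' Iff.rfl
      (CondBoxStub.xor_congr' ⟨fun h => h.1, fun h => ⟨h, hAs v hv⟩⟩ ?_)
    rw [Finset.filter_congr fun f hf => hP _ (hF v hv f (Finset.mem_product.1 hf).1)]
  -- INDEPENDENCE (disjoint coordinates): off-axis events vs the axis cylinder, right vs left
  have hindC : ∀ X : Set Ω, MeasurableSet X →
      (∀ ω : Ω, ((ω.1 ∩ {x | x ≠ 0}, (ω.2.1 ∩ ∅, (ω.2.2.1 ∩ Set.univ, (ω.2.2.2.1 ∩ Set.univ,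
        ω.2.2.2.2 ∩ Set.univ)))) : Ω) ∈ X ↔ ω ∈ X) →
      μIK.real (X ∩ Cyl) = μIK.real X * μIK.real Cyl := fun X hX hX' =>
    CondBoxStub.real_inter_eq_mul (A₁ := {x | x ≠ 0}) (A₂ := {x | x = 0}) (B₁ := ∅) (B₂ := Set.univ)
      (P₁ := Set.univ) (P₂ := ∅) (Q₁ := Set.univ) (Q₂ := ∅) (C₁ := Set.univ) (C₂ := ∅)
      (Set.disjoint_left.2 fun x (hx : x ≠ 0) (hx' : x = 0) => hx hx') disjoint_bot_left disjoint_bot_right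
      disjoint_bot_right disjoint_bot_right hX mCyl hX' fun ω => forall_congr' fun j => iff_congr
        (CondBoxStub.xor_congr' ⟨fun h => h.1, fun h => ⟨h, Set.mem_univ _⟩⟩ ⟨fun h => h.1, fun h => ⟨h, rfl⟩⟩)
        Iff.rfl
  have hindAB : μIK.real (tw ⁻¹' A ∩ tw ⁻¹' B) = μIK.real (tw ⁻¹' A) * μIK.real (tw ⁻¹' B) :=
    CondBoxStub.real_inter_eq_mul (A₁ := {x | 1 ≤ x}) (A₂ := {x | x ≤ -1}) (B₁ := ∅) (B₂ := ∅)
      (P₁ := {f | 0 ≤ f 0}) (P₂ := {f | f 0 < 0}) (Q₁ := {f | 0 ≤ f 0}) (Q₂ := {f | f 0 < 0}) (C₁ := {f | 1 ≤ f 0})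
      (C₂ := {f | f 0 ≤ -1}) (Set.disjoint_left.2 fun x (hx : 1 ≤ x) (hx' : x ≤ -1) => by omega) disjoint_bot_left
      (Set.disjoint_left.2 fun f (hf : 0 ≤ f 0) (hf' : f 0 < 0) => by omega)
      (Set.disjoint_left.2 fun f (hf : 0 ≤ f 0) (hf' : f 0 < 0) => by omega)
      (Set.disjoint_left.2 fun f (hf : 1 ≤ f 0) (hf' : f 0 ≤ -1) => by omega) (mtw hAm) (mtw hBm)
      (hproj hA {x | 1 ≤ x} {f | 0 ≤ f 0} {f | 1 ≤ f 0} (fun v hv => (mem_rtBox.1 hv).1)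
        (fun v hv f hf => faces_right _ (by have := (mem_rtBox.1 hv).1; omega) f hf)
        fun v hv => (mem_rtBox.1 hv).1)
      (hproj hB {x | x ≤ -1} {f | f 0 < 0} {f | f 0 ≤ -1} (fun v hv => (mem_lfBox.1 hv).2.1)
        (fun v hv f hf => faces_left _ (by have := (mem_lfBox.1 hv).2.1; omega) f hf)
        fun v hv => (mem_lfBox.1 hv).2.1)
  -- MASS OF THE AXIS CYLINDER: `2^{-k}` (a row-sign cylinder for either value of `A 0`)
  have hCylval : μIK.real Cyl = (1 / 2) ^ k := by
    have mA0 : MeasurableSet {ω : Ω | (0 : ℤ) ∈ ω.1} := measurableSet_setOf.2 (mA 0)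
    have hsplit : ∀ (q : Bool) (Y : Set Ω), MeasurableSet Y → (∀ ω ∈ Y, ((0 : ℤ) ∈ ω.1 ↔ q = true)) →
        (∀ ω : Ω, ((ω.1 ∩ Set.univ, (ω.2.1 ∩ ∅, (ω.2.2.1 ∩ ∅, (ω.2.2.2.1 ∩ ∅, ω.2.2.2.2 ∩ ∅)))) : Ω) ∈ Y ↔
          ω ∈ Y) → μIK.real (Cyl ∩ Y) = (1 / 2) ^ k * μIK.real Y := by
      intro q Y hY hq hY'
      have he : Cyl ∩ Y = {ω : Ω | ∀ j : Fin k, (b + j ∈ ω.2.1 ↔ xor (ζ j) q = true)} ∩ Y := by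
        ext ω
        constructor
        · rintro ⟨hc, hy⟩; exact ⟨fun j => (xor_iff_iff (hq ω hy) (ζ j)).1 (hc j), hy⟩
        · rintro ⟨hc, hy⟩; exact ⟨fun j => (xor_iff_iff (hq ω hy) (ζ j)).2 (hc j), hy⟩
      rw [he, ← real_rowSignCyl b k fun j => xor (ζ j) q]
      exact CondBoxStub.real_inter_eq_mul (A₁ := ∅) (A₂ := Set.univ) (B₁ := Set.univ) (B₂ := ∅) (P₁ := ∅)
        (P₂ := ∅) (Q₁ := ∅) (Q₂ := ∅) (C₁ := ∅) (C₂ := ∅) disjoint_bot_left disjoint_bot_right disjoint_bot_left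
        disjoint_bot_left disjoint_bot_left (measurableSet_setOf.2 (Measurable.forall fun j =>
          (mB _).iff measurable_const)) hY
        (fun ω => forall_congr' fun j => iff_congr ⟨fun h => h.1, fun h => ⟨h, Set.mem_univ _⟩⟩ Iff.rfl) hY'
    rw [← measureReal_inter_add_sdiff (μ := μIK) (s := Cyl) mA0, Set.sdiff_eq,
      hsplit true _ mA0 (fun ω hω => ⟨fun _ => rfl, fun _ => hω⟩)
        (fun ω => ⟨fun h => h.1, fun h => ⟨h, Set.mem_univ _⟩⟩),
      hsplit false _ mA0.compl (fun ω hω => ⟨fun h => absurd h hω, fun h => absurd h Bool.false_ne_true⟩)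
        (fun ω => not_congr ⟨fun h => h.1, fun h => ⟨h, Set.mem_univ _⟩⟩),
      ← mul_add, measureReal_add_measureReal_compl mA0, probReal_univ, mul_one]
  -- ASSEMBLY
  have hoffR : ∀ v ∈ rtBox b k h, b ≤ v 1 ∧ v 1 < b + k ∧ v 0 ≠ 0 := fun v hv =>
    ⟨(mem_rtBox.1 hv).2.2.1, (mem_rtBox.1 hv).2.2.2, by have := (mem_rtBox.1 hv).1; omega⟩
  have hoffL : ∀ v ∈ lfBox b k h, b ≤ v 1 ∧ v 1 < b + k ∧ v 0 ≠ 0 := fun v hv =>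
    ⟨(mem_lfBox.1 hv).2.2.1, (mem_lfBox.1 hv).2.2.2, by have := (mem_lfBox.1 hv).2.1; omega⟩
  have hkA := hkey hA hoffR
  have hkB := hkey hB hoffL
  have hXA := hproj hA {x : ℤ | x ≠ 0} Set.univ Set.univ (fun v hv => (hoffR v hv).2.2)
    (fun _ _ _ _ => Set.mem_univ _) fun _ _ => Set.mem_univ _
  have hXB := hproj hB {x : ℤ | x ≠ 0} Set.univ Set.univ (fun v hv => (hoffL v hv).2.2)
    (fun _ _ _ _ => Set.mem_univ _) fun _ _ => Set.mem_univ _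
  rw [hν (hAm.inter hBm) (fun ω hω => and_congr (hkA ω hω) (hkB ω hω)), hν hAm hkA, hν hBm hkB,
    Set.preimage_inter, hindC _ ((mtw hAm).inter (mtw hBm)) (fun ω => and_congr (hXA ω) (hXB ω)),
    hindC _ (mtw hAm) hXA, hindC _ (mtw hBm) hXB, hindAB, hCylval]
  have h2 : (2 : ℝ) ^ k * (1 / 2) ^ k = 1 := by rw [← mul_pow]; norm_num
  generalize μIK.real (tw ⁻¹' A) = x
  generalize μIK.real (tw ⁻¹' B) = y
  linear_combination (-(x * y * (1 / 2 : ℝ) ^ k)) * h2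

end ColFactorisationStub

/-- **Registered stub `stub_colFactorisation`** (COLUMN FACTORISATION, line `defect-closure-exploration`): the
exact Markov property of the gauge colour field across the anchor cell column `0` in finite cylinder form, for every
column pattern `S` — given the colours of the axis-column window, an event read on the right half-box and an event
read on the left half-box are independent and the window is uniform: `ν(A ∩ B ∩ C_ζ) = 2^k ν(A ∩ C_ζ) ν(B ∩ C_ζ)`. -/
theorem stub_colFactorisation : ColFactorisation := by
  intro S b k h A B hAm hBm hA hB ζ
  exact ColFactorisationStub.main S b k h hAm hBm hA hB ζ

end Summit.CriticalPhenomena.CardyFormulaZ2.Cruxes.IKMixedBoxCrossing.DefectClosureExploration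

end
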